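import Mathlib
import Summits.AtomisticToContinuum.Crystallization.Theses.EnergyDerivativeOrder
import Literature.Geometry.DiscreteGeometry.LayerStackings
import Summits.AtomisticToContinuum.Crystallization.Theorems.EnergyDerivativeOrderLimitTransferHcpShells

/-!
# Birth skeleton — piece P2 `ShellsPropagateToBarlow` of the split of C2 `SpectralRigidityHcp`
# (route EnergyDerivativeOrder, stmt-AtomisticToContinuum-12278; crux-strategist 2026-08-17)

Line = Hales, *Dense Sphere Packings* §1.3 transplanted to the relaxed two-radius shells, in the
frame conventions of `BarlowStacking.lean` (`triangularVec₁ a = u`, `triangularVec₂ a = v`):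
* `stub_firstLayer` — A FIRST FULL TRIANGULAR LAYER `y₀ + A(ℤu + ℤv) ⊆ Y` (non-ideal ratio: the six
  radius-`a` points of a shell ARE its in-plane hexagon and the shell of an in-plane neighbour
  shares three non-collinear points of that plane, so hexagons are coplanar and the layer closes
  up by induction; ideal ratio: `LayerPropagation.exists_frame_layer_subset`);
* `stub_layerToStacking` — ONE LAYER FORCES ALL, AND NO ROOM: from a full layer through `y₀` in the
  frame `A`, hole triples of one type per side and per layer (two hole points of different types
  over adjacent sites would be two points of `Y` at distance `a/√3 < min(a,a')`), iterated up and
  down (`LayerStackings.exists_next_layer` / `exists_barlowStacking_subset` pattern), give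
  `(y₀ + A ·) '' barlowStacking a h s ⊆ Y` for a Hägg sequence `s`; equality because every point of
  `ℝ³` is within `√(4a²/9 + h²/4) < min(a, a')` of the stacking (`exists_dist_barlowPos_lt_two`
  rescaled) while the shells make distinct points of `Y` at least `min(a,a')` apart.
`ShellsPropagateToBarlow_of` upgrades the linear isometry `A` to an isometry equivalence of `ℝ³`
(finite dimension) composed with the translation by `y₀`.  The piece is restated verbatim
(`def ShellsPropagateToBarlow`) until the route split installs `EnergyDerivativeOrder.ShellsPropagateToBarlow`.
-/

noncomputable section

namespace Summit.AtomisticToContinuum.Crystallization.Cruxes.SpectralRigidityHcp.ShellsPropagateToBarlowBirth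

open Literature.MathematicalPhysics.StatisticalMechanics

/-- Piece P2 of the C2 split (verbatim; becomes `EnergyDerivativeOrder.ShellsPropagateToBarlow`). -/
def ShellsPropagateToBarlow : Prop :=
  ∀ a h : ℝ, 0 < a → |h / a - Real.sqrt (2 / 3)| ≤ 1 / 400 → ∀ Y : Set (EuclideanSpace ℝ (Fin 3)), Y.Nonempty → (∀ y ∈ Y, ∃ A : EuclideanSpace ℝ (Fin 3) →ₗᵢ[ℝ] EuclideanSpace ℝ (Fin 3), {y' ∈ Y | y' ≠ y ∧ dist y y' ≤ 6 / 5 * a} = (fun p => y + A p) '' {p ∈ hcpStacking a h | p ≠ 0 ∧ dist 0 p ≤ 6 / 5 * a} ∨ {y' ∈ Y | y' ≠ y ∧ dist y y' ≤ 6 / 5 * a} = (fun p => y + A p) '' {p ∈ fccStacking a h | p ≠ 0 ∧ dist 0 p ≤ 6 / 5 * a}) → ∃ s : ℤ → ℤ, IsHaggSeq s ∧ ∃ g : EuclideanSpace ℝ (Fin 3) ≃ᵢ EuclideanSpace ℝ (Fin 3), Y = g '' barlowStacking a h s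

/-- STUB (first layer; M/L): some full triangular layer `y₀ + A(ℤu + ℤv)` lies in `Y`. -/
theorem stub_firstLayer :
    ∀ a h : ℝ, 0 < a → |h / a - Real.sqrt (2 / 3)| ≤ 1 / 400 → ∀ Y : Set (EuclideanSpace ℝ (Fin 3)), Y.Nonempty → (∀ y ∈ Y, ∃ A : EuclideanSpace ℝ (Fin 3) →ₗᵢ[ℝ] EuclideanSpace ℝ (Fin 3), {y' ∈ Y | y' ≠ y ∧ dist y y' ≤ 6 / 5 * a} = (fun p => y + A p) '' {p ∈ hcpStacking a h | p ≠ 0 ∧ dist 0 p ≤ 6 / 5 * a} ∨ {y' ∈ Y | y' ≠ y ∧ dist y y' ≤ 6 / 5 * a} = (fun p => y + A p) '' {p ∈ fccStacking a h | p ≠ 0 ∧ dist 0 p ≤ 6 / 5 * a}) → ∃ y₀ ∈ Y, ∃ A : EuclideanSpace ℝ (Fin 3) →ₗᵢ[ℝ] EuclideanSpace ℝ (Fin 3), ∀ i j : ℤ, y₀ + A ((i : ℝ) • triangularVec₁ a + (j : ℝ) • triangularVec₂ a) ∈ Y := by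
  sorry

/-- STUB (layers propagate and leave no room; L): a full layer through `y₀` in the frame `A`
forces `Y = (y₀ + A ·) '' barlowStacking a h s` for a Hägg sequence `s`. -/
theorem stub_layerToStacking :
    ∀ a h : ℝ, 0 < a → |h / a - Real.sqrt (2 / 3)| ≤ 1 / 400 → ∀ Y : Set (EuclideanSpace ℝ (Fin 3)), (∀ y ∈ Y, ∃ A : EuclideanSpace ℝ (Fin 3) →ₗᵢ[ℝ] EuclideanSpace ℝ (Fin 3), {y' ∈ Y | y' ≠ y ∧ dist y y' ≤ 6 / 5 * a} = (fun p => y + A p) '' {p ∈ hcpStacking a h | p ≠ 0 ∧ dist 0 p ≤ 6 / 5 * a} ∨ {y' ∈ Y | y' ≠ y ∧ dist y y' ≤ 6 / 5 * a} = (fun p => y + A p) '' {p ∈ fccStacking a h | p ≠ 0 ∧ dist 0 p ≤ 6 / 5 * a}) → ∀ y₀ ∈ Y, ∀ A : EuclideanSpace ℝ (Fin 3) →ₗᵢ[ℝ] EuclideanSpace ℝ (Fin 3), (∀ i j : ℤ, y₀ + A ((i : ℝ) • triangularVec₁ a + (j : ℝ) • triangularVec₂ a) ∈ Y) → ∃ s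 : ℤ → ℤ, IsHaggSeq s ∧ Y = (fun p => y₀ + A p) '' barlowStacking a h s := by
  sorry

/-- **Composition**: first layer, then propagation; the frame `p ↦ y₀ + A p` is an isometry
equivalence of `ℝ³` (a linear isometry of a finite-dimensional space is onto). -/
theorem ShellsPropagateToBarlow_of
    (hF : ∀ a h : ℝ, 0 < a → |h / a - Real.sqrt (2 / 3)| ≤ 1 / 400 → ∀ Y : Set (EuclideanSpace ℝ (Fin 3)), Y.Nonempty → (∀ y ∈ Y, ∃ A : EuclideanSpace ℝ (Fin 3) →ₗᵢ[ℝ] EuclideanSpace ℝ (Fin 3), {y' ∈ Y | y' ≠ y ∧ dist y y' ≤ 6 / 5 * a} = (fun p => y + A p) '' {p ∈ hcpStacking a h | p ≠ 0 ∧ dist 0 p ≤ 6 / 5 * a} ∨ {y' ∈ Y | y' ≠ y ∧ dist y y' ≤ 6 / 5 * a} = (fun p => y + A p) '' {p ∈ fccStacking a h | p ≠ 0 ∧ dist 0 p ≤ 6 / 5 * a}) → ∃ y₀ ∈ Y, ∃ A : EuclideanSpace ℝ (Fin 3) →ₗᵢ[ℝ] EuclideanSpace ℝ (Fin 3), ∀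 i j : ℤ, y₀ + A ((i : ℝ) • triangularVec₁ a + (j : ℝ) • triangularVec₂ a) ∈ Y)
    (hL : ∀ a h : ℝ, 0 < a → |h / a - Real.sqrt (2 / 3)| ≤ 1 / 400 → ∀ Y : Set (EuclideanSpace ℝ (Fin 3)), (∀ y ∈ Y, ∃ A : EuclideanSpace ℝ (Fin 3) →ₗᵢ[ℝ] EuclideanSpace ℝ (Fin 3), {y' ∈ Y | y' ≠ y ∧ dist y y' ≤ 6 / 5 * a} = (fun p => y + A p) '' {p ∈ hcpStacking a h | p ≠ 0 ∧ dist 0 p ≤ 6 / 5 * a} ∨ {y' ∈ Y | y' ≠ y ∧ dist y y' ≤ 6 / 5 * a} = (fun p => y + A p) '' {p ∈ fccStacking a h | p ≠ 0 ∧ dist 0 p ≤ 6 / 5 * a}) → ∀ y₀ ∈ Y, ∀ A : EuclideanSpace ℝ (Fin 3) →ₗᵢ[ℝ] EuclideanSpace ℝ (Fin 3), (∀ i j : ℤ, y₀ + A ((i : ℝ) • triangularVec₁ a + (j : ℝ) • triangularVec₂ a) ∈ Y) → ∃ s : ℤ → ℤ, IsHaggSeq s ∧ Y = (fun p => y₀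 + A p) '' barlowStacking a h s) :
    ShellsPropagateToBarlow := by
  intro a h ha hwin Y hY hsh
  obtain ⟨y₀, hy₀, A, hlay⟩ := hF a h ha hwin Y hY hsh
  obtain ⟨s, hs, hYeq⟩ := hL a h ha hwin Y hsh y₀ hy₀ A hlay
  let L : EuclideanSpace ℝ (Fin 3) ≃ₗᵢ[ℝ] EuclideanSpace ℝ (Fin 3) := A.toLinearIsometryEquiv rfl
  refine ⟨s, hs, L.toIsometryEquiv.trans (IsometryEquiv.addLeft y₀), ?_⟩
  rw [hYeq]
  refine Set.image_congr fun p _ => ?_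
  simp [L, IsometryEquiv.addLeft]

end Summit.AtomisticToContinuum.Crystallization.Cruxes.SpectralRigidityHcp.ShellsPropagateToBarlowBirth

end
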